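import Mathlib
import HarnessLib
import Summits.HubbardSuperconductivity.HubbardSuperconductivity.Theorems.KLProgrammeKLRegimeTwoVolumeTowerStepCovTelescopeTop

/-!
# K3 VL child `KLRegimeVolumeLimitV17F2` (stmt-HubbardSuperconductivity-20440), located item #23 «W2-HALF-VL», part 5: THE TRANSFER DOOR ALONG THE FLOW
# CHAIN WITH PIECES IN THE `Λ_T`-CURRENCY — `TransferWtData (klTowerTransfer (b·L) M β μ K_{m₀+d} (k+1)) … Λ_T (Cr + Σ_{i<d}(χ i + χ′ i) + 1)` from the
# base at `K_{m₀}` (tree weight `klScaleWt (k+1)`) and per-step `(1 + Λ_T·tnorm)`-weighted rows / columns of the re-analysis increments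

Cell `gate-hubbard-kl`, seat p3 (g15), lead of #23.  The part-4 door `transferWtData_klTowerTransfer_flow_of_pieces` (`…TowerStepCovTelescopeTop`) takes the
pieces `χ i, χ′ i` in the TREE currency `klScaleWt (b·L) M β (k+1)` and only afterwards (`transferWtData_klSrcTransfer_of_rowColSumWt`) downgrades to the
`1 + Λ_T·tnorm` currency that `TransferWtData` actually reads.  For the (R-row/col) pieces of «W2H-OVL» this order is costly (located note
«W2H-OVL-CURRENCY»: the tree weight forces a domination constant `∝ Λ_{k+1}·x` on a piece at depth `x`, so the per-piece bound is `x`-free and the sum over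
`≈ n⋆` pieces is not `U`-uniform).  Downgrading FIRST costs nothing: the telescope bookkeeping `sum_norm_chain_le_of_steps` is weight-generic, the base
converts by `rowWt_/colWt_tnorm_le_of_klScaleWt`, and the transfer assembly only ever used the `Λ_T`-rows.  So:

* `transferWtData_klSrcTransfer_of_rowColSumTn` — `TransferWtData (klSrcTransfer (b·L) M β μ K k) … Λ_T (Cr + 1)` from `(1 + Λ_T·tnorm)`-weighted rows and
  columns `≤ Cr` of `klReanalysis (b·L) M β μ K k` (any frame, any `Λ_T ≥ 0`);
* `rowColSumTn_klReanalysis_of_frame_telescope` — base at `K m₀` in the tree currency (`Λ_T ≤ Λ_{k+1}`) + pieces in the `Λ_T`-currency ⇒ last-frame rows /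
  columns in the `Λ_T`-currency `≤ Cr + Σ χ` / `≤ Cr + Σ χ′`;
* `transferWtData_klSrcTransfer_of_frame_telescope_tn` — the bundle at the last frame, `Cr + Σ_{i<d}(χ i + χ′ i) + 1`;
* **`transferWtData_klTowerTransfer_flow_of_pieces_tn (d₀)`** — the door along `K_i = klFlowFrameU L M β U μ i` (binders of the part-4 door verbatim, pieces
  in the `Λ_T`-currency): this is the form the «W2H-OVL» regime file feeds (`rowSumTn_klReanalysis_sub_le_of_rates`, part 15, with `D_w = 1`).

Everything is proved; no definitions; nothing asserts any stub, K3, VL or superconductivity. [cite: BenfattoGiulianiMastropietro2006, §2.7 (2.70)–(2.71a), §3 (3.2)–(3.8)]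
-/

noncomputable section

namespace Summit.HubbardSuperconductivity.HubbardSuperconductivity.Theorems.TorusFourierL2

set_option linter.dupNamespace false -- summit = problem name (single-conjunct summit), D-0017

open Set Finset Literature.MathematicalPhysics.QuantumLattice Literature.MathematicalPhysics.QuantumLattice.BandSectorCounting
open Literature.MathematicalPhysics.QuantumLattice.FermiRG Literature.Probability.LatticeModels Literature.Analysis.SpecialFunctions
open Summit.HubbardSuperconductivity.HubbardSuperconductivity.Theorems.DispersionFlow
open Summit.HubbardSuperconductivity.HubbardSuperconductivity.Theorems.KLRegimeSplit
open Summit.HubbardSuperconductivity.HubbardSuperconductivity.Theorems.KLProgrammeLegKernels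
open Summit.HubbardSuperconductivity.HubbardSuperconductivity.Theorems.PerturbedFermiCurve
open Summit.HubbardSuperconductivity.HubbardSuperconductivity.Theorems.KLRegimeWick
open Summit.HubbardSuperconductivity.HubbardSuperconductivity.Theorems.EngineV8
open Summit.HubbardSuperconductivity.HubbardSuperconductivity.Theorems.TwoVolumeSource
open Summit.HubbardSuperconductivity.HubbardSuperconductivity.Theorems.TwoVolumeDefect
open scoped Real

open Classical

section Bundle

variable {L b M : ℕ} [NeZero L] [NeZero (b * L)] [NeZero M]

/-- **`TransferWtData` of the doubled transfer `T⁺_k` at ANY frame from `(1 + Λ_T·tnorm)`-weighted rows and columns of its re-analysis block**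
(any `Λ_T ≥ 0`; copy `1` = the slot shift, rows/columns `≤ 1`; block covariance `norm_klSrcTransfer_blockCovariant`).
[cite: BenfattoGiulianiMastropietro2006, §2.7 (2.70)–(2.71a), §3 (3.2)–(3.8)] -/
theorem transferWtData_klSrcTransfer_of_rowColSumTn {β : ℝ} (hβ : 0 < β) (μ : ℝ) (K : TrigPolyC4v) (k : ℕ) {Cr ΛT : ℝ} (hCr : 0 ≤ Cr)
    (hΛT : 0 ≤ ΛT)
    (hrow : ∀ X'' : SpaceTimeIdx (b * L) M × SectorLeg (sectorCount (k + 1)),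
      ∑ X' : SpaceTimeIdx (b * L) M × SectorLeg (sectorCount k), ‖klReanalysis (b * L) M β μ K k X'' X'‖ *
        (1 + ΛT * (Torus.tnorm (X''.1.2 - X'.1.2) : ℝ)) ≤ Cr)
    (hcol : ∀ X' : SpaceTimeIdx (b * L) M × SectorLeg (sectorCount k),
      ∑ X'' : SpaceTimeIdx (b * L) M × SectorLeg (sectorCount (k + 1)), ‖klReanalysis (b * L) M β μ K k X'' X'‖ *
        (1 + ΛT * (Torus.tnorm (X''.1.2 - X'.1.2) : ℝ)) ≤ Cr) :
    TransferWtData (klSrcTransfer (b * L) M β μ K k) (klBlockEquivD L b M (k + 1)) (klBlockEquivD L b M k) ΛT (Cr + 1) where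
  ΛT_nonneg := hΛT
  cW_nonneg := by positivity
  row x := by
    obtain ⟨X'', c⟩ := x
    have hre := hrow X''
    have hsh := sum_norm_klSlotShift_mul_wt_row_le (V := b * L) (M := M) k ΛT X''
    revert c
    rw [Fin.forall_fin_two]
    refine ⟨?_, ?_⟩
    · rw [Fintype.sum_prod_type]
      simp_rw [Fin.sum_univ_two, klSrcTransfer_apply_zero_zero, klSrcTransfer_apply_zero_one, norm_zero, zero_mul, add_zero]
      linarith
    · rw [Fintype.sum_prod_type]
      simp_rw [Fin.sum_univ_two, klSrcTransfer_apply_one_zero, klSrcTransfer_apply_one_one, norm_zero, zero_mul, zero_add]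
      linarith
  col y' := by
    obtain ⟨X', c'⟩ := y'
    have hre := hcol X'
    have hsh := sum_norm_klSlotShift_mul_wt_col_le (V := b * L) (M := M) k ΛT X'
    revert c'
    rw [Fin.forall_fin_two]
    refine ⟨?_, ?_⟩
    · rw [Fintype.sum_prod_type]
      simp_rw [Fin.sum_univ_two, klSrcTransfer_apply_zero_zero, klSrcTransfer_apply_one_zero, norm_zero, zero_mul, add_zero]
      linarith
    · rw [Fintype.sum_prod_type]
      simp_rw [Fin.sum_univ_two, klSrcTransfer_apply_zero_one, klSrcTransfer_apply_one_one, norm_zero, zero_mul, zero_add]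
      linarith
  cov δ β' β₁ xbar y := norm_klSrcTransfer_blockCovariant hβ.ne' μ K k δ β' β₁ xbar y

end Bundle

section Telescope

variable {V M : ℕ} [NeZero V] [NeZero M]

/-- **`Λ_T`-weighted rows and columns of `klReanalysis` at the last frame of a frame chain**: base rows/columns at `K m₀` in the tree currency
`klScaleWt V M β (k+1)` (`0 ≤ β`, `Λ_T ≤ Λ_{k+1}`) plus per-step bounds `χ i` (rows) and `χ′ i` (columns) on the `(1 + Λ_T·tnorm)`-weighted rows/columns of the
increments `klReanalysis[K_{i+1}] k − klReanalysis[K_i] k`. [cite: BenfattoGiulianiMastropietro2006, §2.7 (2.71a), §3 (3.3)] -/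
theorem rowColSumTn_klReanalysis_of_frame_telescope {β : ℝ} (hβ : 0 ≤ β) (μ : ℝ) (K : ℕ → TrigPolyC4v) (k m₀ d : ℕ) {Cr ΛT : ℝ}
    (hΛT : 0 ≤ ΛT) (hΛTle : ΛT ≤ klScale klE0 (k + 1))
    (hbrow : ∀ X'' : SpaceTimeIdx V M × SectorLeg (sectorCount (k + 1)),
      ∑ X' : SpaceTimeIdx V M × SectorLeg (sectorCount k), ‖klReanalysis V M β μ (K m₀) k X'' X'‖ *
        EngineV8.klScaleWt V M β (k + 1) {EngineV8.latticeLegPos (2 * (2 * M)) X'', EngineV8.latticeLegPos (2 * (2 * M)) X'} ≤ Cr)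
    (hbcol : ∀ X' : SpaceTimeIdx V M × SectorLeg (sectorCount k),
      ∑ X'' : SpaceTimeIdx V M × SectorLeg (sectorCount (k + 1)), ‖klReanalysis V M β μ (K m₀) k X'' X'‖ *
        EngineV8.klScaleWt V M β (k + 1) {EngineV8.latticeLegPos (2 * (2 * M)) X'', EngineV8.latticeLegPos (2 * (2 * M)) X'} ≤ Cr)
    (χ χ' : ℕ → ℝ)
    (hrow : ∀ i < d, ∀ X'' : SpaceTimeIdx V M × SectorLeg (sectorCount (k + 1)),
      ∑ X' : SpaceTimeIdx V M × SectorLeg (sectorCount k),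
        ‖(klReanalysis V M β μ (K (m₀ + i + 1)) k - klReanalysis V M β μ (K (m₀ + i)) k) X'' X'‖ *
          (1 + ΛT * (Torus.tnorm (X''.1.2 - X'.1.2) : ℝ)) ≤ χ i)
    (hcol : ∀ i < d, ∀ X' : SpaceTimeIdx V M × SectorLeg (sectorCount k),
      ∑ X'' : SpaceTimeIdx V M × SectorLeg (sectorCount (k + 1)),
        ‖(klReanalysis V M β μ (K (m₀ + i + 1)) k - klReanalysis V M β μ (K (m₀ + i)) k) X'' X'‖ *
          (1 + ΛT * (Torus.tnorm (X''.1.2 - X'.1.2) : ℝ)) ≤ χ' i) :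
    (∀ X'' : SpaceTimeIdx V M × SectorLeg (sectorCount (k + 1)),
      ∑ X' : SpaceTimeIdx V M × SectorLeg (sectorCount k), ‖klReanalysis V M β μ (K (m₀ + d)) k X'' X'‖ *
        (1 + ΛT * (Torus.tnorm (X''.1.2 - X'.1.2) : ℝ)) ≤ Cr + ∑ i ∈ range d, χ i) ∧
    (∀ X' : SpaceTimeIdx V M × SectorLeg (sectorCount k),
      ∑ X'' : SpaceTimeIdx V M × SectorLeg (sectorCount (k + 1)), ‖klReanalysis V M β μ (K (m₀ + d)) k X'' X'‖ *
        (1 + ΛT * (Torus.tnorm (X''.1.2 - X'.1.2) : ℝ)) ≤ Cr + ∑ i ∈ range d, χ' i) := by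
  have hw : ∀ (X'' : SpaceTimeIdx V M × SectorLeg (sectorCount (k + 1))) (X' : SpaceTimeIdx V M × SectorLeg (sectorCount k)),
      0 ≤ 1 + ΛT * (Torus.tnorm (X''.1.2 - X'.1.2) : ℝ) := fun X'' X' => by positivity
  -- the base in the `Λ_T`-currency
  have hbrow' : ∀ X'' : SpaceTimeIdx V M × SectorLeg (sectorCount (k + 1)),
      ∑ X' : SpaceTimeIdx V M × SectorLeg (sectorCount k), ‖klReanalysis V M β μ (K m₀) k X'' X'‖ *
        (1 + ΛT * (Torus.tnorm (X''.1.2 - X'.1.2) : ℝ)) ≤ Cr := fun X'' =>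
    rowWt_tnorm_le_of_klScaleWt hβ hΛTle _ X'' (hbrow X'')
  have hbcol' : ∀ X' : SpaceTimeIdx V M × SectorLeg (sectorCount k),
      ∑ X'' : SpaceTimeIdx V M × SectorLeg (sectorCount (k + 1)), ‖klReanalysis V M β μ (K m₀) k X'' X'‖ *
        (1 + ΛT * (Torus.tnorm (X''.1.2 - X'.1.2) : ℝ)) ≤ Cr := fun X' =>
    colWt_tnorm_le_of_klScaleWt hβ hΛTle _ X' (hbcol X')
  refine ⟨fun X'' => ?_, fun X' => ?_⟩
  · have h := sum_norm_chain_le_of_steps (σ := SpaceTimeIdx V M × SectorLeg (sectorCount k)) (fun i => klReanalysis V M β μ (K i) k)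
      Finset.univ (fun _ => X'') id (fun X' => 1 + ΛT * (Torus.tnorm (X''.1.2 - X'.1.2) : ℝ))
      (fun X' => hw X'' X') m₀ d χ (fun i hi => by simpa only [id] using hrow i hi X'')
    simp only [id] at h
    exact h.trans (add_le_add (hbrow' X'') le_rfl)
  · have h := sum_norm_chain_le_of_steps (σ := SpaceTimeIdx V M × SectorLeg (sectorCount (k + 1))) (fun i => klReanalysis V M β μ (K i) k)
      Finset.univ id (fun _ => X') (fun X'' => 1 + ΛT * (Torus.tnorm (X''.1.2 - X'.1.2) : ℝ))
      (fun X'' => hw X'' X') m₀ d χ' (fun i hi => by simpa only [id] using hcol i hi X')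
    simp only [id] at h
    exact h.trans (add_le_add (hbcol' X') le_rfl)

end Telescope

section TransferBundle

variable {L b M : ℕ} [NeZero L] [NeZero (b * L)] [NeZero M]

/-- **`TransferWtData` of the doubled transfer at the last frame of a frame chain, pieces in the `Λ_T`-currency** (fine lattice `b·L`):
`TransferWtData (klSrcTransfer (b·L) M β μ (K (m₀+d)) k) (klBlockEquivD L b M (k+1)) (klBlockEquivD L b M k) Λ_T (Cr + Σ_{i<d}(χ i + χ′ i) + 1)` for every
`0 ≤ Λ_T ≤ Λ_{k+1}` and `0 ≤ Cr`. [cite: BenfattoGiulianiMastropietro2006, §2.7 (2.70)–(2.71a), §3 (3.2)–(3.8)] -/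
theorem transferWtData_klSrcTransfer_of_frame_telescope_tn {β : ℝ} (hβ : 0 < β) (μ : ℝ) (K : ℕ → TrigPolyC4v) (k m₀ d : ℕ) {Cr ΛT : ℝ}
    (hCr : 0 ≤ Cr) (hΛT : 0 ≤ ΛT) (hΛTle : ΛT ≤ klScale klE0 (k + 1))
    (hbrow : ∀ X'' : SpaceTimeIdx (b * L) M × SectorLeg (sectorCount (k + 1)),
      ∑ X' : SpaceTimeIdx (b * L) M × SectorLeg (sectorCount k), ‖klReanalysis (b * L) M β μ (K m₀) k X'' X'‖ *
        EngineV8.klScaleWt (b * L) M β (k + 1) {EngineV8.latticeLegPos (2 * (2 * M)) X'', EngineV8.latticeLegPos (2 * (2 * M)) X'} ≤ Cr)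
    (hbcol : ∀ X' : SpaceTimeIdx (b * L) M × SectorLeg (sectorCount k),
      ∑ X'' : SpaceTimeIdx (b * L) M × SectorLeg (sectorCount (k + 1)), ‖klReanalysis (b * L) M β μ (K m₀) k X'' X'‖ *
        EngineV8.klScaleWt (b * L) M β (k + 1) {EngineV8.latticeLegPos (2 * (2 * M)) X'', EngineV8.latticeLegPos (2 * (2 * M)) X'} ≤ Cr)
    (χ χ' : ℕ → ℝ) (hχ : ∀ i < d, 0 ≤ χ i) (hχ' : ∀ i < d, 0 ≤ χ' i)
    (hrow : ∀ i < d, ∀ X'' : SpaceTimeIdx (b * L) M × SectorLeg (sectorCount (k + 1)),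
      ∑ X' : SpaceTimeIdx (b * L) M × SectorLeg (sectorCount k),
        ‖(klReanalysis (b * L) M β μ (K (m₀ + i + 1)) k - klReanalysis (b * L) M β μ (K (m₀ + i)) k) X'' X'‖ *
          (1 + ΛT * (Torus.tnorm (X''.1.2 - X'.1.2) : ℝ)) ≤ χ i)
    (hcol : ∀ i < d, ∀ X' : SpaceTimeIdx (b * L) M × SectorLeg (sectorCount k),
      ∑ X'' : SpaceTimeIdx (b * L) M × SectorLeg (sectorCount (k + 1)),
        ‖(klReanalysis (b * L) M β μ (K (m₀ + i + 1)) k - klReanalysis (b * L) M β μ (K (m₀ + i)) k) X'' X'‖ *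
          (1 + ΛT * (Torus.tnorm (X''.1.2 - X'.1.2) : ℝ)) ≤ χ' i) :
    TransferWtData (klSrcTransfer (b * L) M β μ (K (m₀ + d)) k) (klBlockEquivD L b M (k + 1)) (klBlockEquivD L b M k) ΛT
      (Cr + ∑ i ∈ range d, (χ i + χ' i) + 1) := by
  obtain ⟨hr, hc⟩ := rowColSumTn_klReanalysis_of_frame_telescope (V := b * L) hβ.le μ K k m₀ d hΛT hΛTle hbrow hbcol χ χ' hrow hcol
  have hχm : ∀ i ∈ range d, 0 ≤ χ i := fun i hi => hχ i (Finset.mem_range.1 hi)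
  have hχm' : ∀ i ∈ range d, 0 ≤ χ' i := fun i hi => hχ' i (Finset.mem_range.1 hi)
  have hsum : ∑ i ∈ range d, χ i ≤ ∑ i ∈ range d, (χ i + χ' i) := Finset.sum_le_sum fun i hi => le_add_of_nonneg_right (hχm' i hi)
  have hsum' : ∑ i ∈ range d, χ' i ≤ ∑ i ∈ range d, (χ i + χ' i) := Finset.sum_le_sum fun i hi => le_add_of_nonneg_left (hχm i hi)
  have hCr' : 0 ≤ Cr + ∑ i ∈ range d, (χ i + χ' i) := add_nonneg hCr (Finset.sum_nonneg fun i hi => add_nonneg (hχm i hi) (hχm' i hi))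
  exact transferWtData_klSrcTransfer_of_rowColSumTn hβ μ (K (m₀ + d)) k hCr' hΛT (fun X'' => (hr X'').trans (by linarith))
    (fun X' => (hc X').trans (by linarith))

set_option maxHeartbeats 1600000 in -- long statement
/-- **`TransferWtData` of the tower's transfer `klTowerTransfer (b·L) … K_{m₀+d} (k+1)` at the end of the flow chain, modulo re-analysis increment pieces IN
THE `Λ_T`-CURRENCY**: base rows / columns at `K_{m₀}` (`k + 1 ≤ m₀`, window `4^{m₀}·U ≤ 4^{2(k+1)+d₀}`), pieces `χ i` / `χ′ i` = `(1 + Λ_T·tnorm)`-weighted rows /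
columns of `klReanalysis[K_{m₀+i+1}] k − klReanalysis[K_{m₀+i}] k` on the fine lattice `b·L` (nonnegative), every `0 ≤ Λ_T ≤ Λ_{k+1}`.
[cite: BenfattoGiulianiMastropietro2006, §2.7 (2.70)–(2.71a), §3 (3.2)–(3.8)] -/
theorem transferWtData_klTowerTransfer_flow_of_pieces_tn (dd : ℕ) :
    ∃ Cr : ℝ, 0 < Cr ∧
      ∀ (G : GeoConsts) (P : SplitConsts) (R : RenConsts) (Q : EngConsts) (cc : ℝ), R.WF2 → 0 < cc → cc ≤ EngineV8.klEngC₃6 P R →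
      ∀ μ ∈ klWindowC, ∀ U : ℝ, 0 < U → U ≤ min (EngineV8.klEngU₀3 P R cc) (1 / (R.Gfr 3 + 1)) →
      ∀ β : ℝ, klBetaMin ≤ β → β ≤ Real.exp (cc / U ^ 2) →
      ∀ (L M : ℕ) [NeZero L] [NeZero M], EngineV8.klEngL₃ β U ≤ L → EngineV8.klEngM₃ β U L ≤ M →
      ∀ m₀ d : ℕ, 1 ≤ m₀ → m₀ + d ≤ nScales β + 1 → HistP klPredsV17F2 L M G P Q R β U μ 0 (m₀ + d) →
        ∀ (b : ℕ) [NeZero (b * L)], EngineV8.klEngL₃ β U ≤ b * L →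
        ∀ k : ℕ, k + 1 ≤ m₀ → (4 : ℝ) ^ m₀ * U ≤ (4 : ℝ) ^ (2 * (k + 1) + dd) →
        ∀ ΛT : ℝ, 0 ≤ ΛT → ΛT ≤ klScale klE0 (k + 1) →
        ∀ χ χ' : ℕ → ℝ, (∀ i < d, 0 ≤ χ i) → (∀ i < d, 0 ≤ χ' i) →
        (∀ i < d, ∀ X'' : SpaceTimeIdx (b * L) M × SectorLeg (sectorCount (k + 1)), ∑ X' : SpaceTimeIdx (b * L) M × SectorLeg (sectorCount k),
          ‖(klReanalysis (b * L) M β μ (klFlowFrameU L M β U μ (m₀ + i + 1)) k - klReanalysis (b * L) M β μ (klFlowFrameU L M β U μ (m₀ + i)) k) X'' X'‖ *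
            (1 + ΛT * (Torus.tnorm (X''.1.2 - X'.1.2) : ℝ)) ≤ χ i) →
        (∀ i < d, ∀ X' : SpaceTimeIdx (b * L) M × SectorLeg (sectorCount k), ∑ X'' : SpaceTimeIdx (b * L) M × SectorLeg (sectorCount (k + 1)),
          ‖(klReanalysis (b * L) M β μ (klFlowFrameU L M β U μ (m₀ + i + 1)) k - klReanalysis (b * L) M β μ (klFlowFrameU L M β U μ (m₀ + i)) k) X'' X'‖ *
            (1 + ΛT * (Torus.tnorm (X''.1.2 - X'.1.2) : ℝ)) ≤ χ' i) →
          TransferWtData (klTowerTransfer (b * L) M β μ (klFlowFrameU L M β U μ (m₀ + d)) (k + 1))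
            (klBlockEquivD L b M (k + 1)) (klBlockEquivD L b M k) ΛT (Cr + ∑ i ∈ range d, (χ i + χ' i) + 1) := by
  obtain ⟨Cr, hCr, hbase⟩ := rowColSumWt_klReanalysis_klEng_flow_deep_vol_at dd
  refine ⟨Cr, hCr, ?_⟩
  intro G P R Q cc hR2 hcc hcc6 μ hμ U hU hUle β hβmin hβc L M _ _ hL3 hM3 m₀ d hm1 hN hhist b _ hV3 k hkm hwin ΛT hΛT0 hΛTle χ χ' hχ hχ' hrow hcol
  have hβ0 : 0 < β := KLRegimeSplit.pos_of_klBetaMin_le hβmin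
  obtain ⟨hbrow, hbcol⟩ := hbase G P R Q cc hR2 hcc hcc6 μ hμ U hU hUle β hβmin hβc L M hL3 hM3 (m₀ + d) hN hhist m₀ hm1 (Nat.le_add_right m₀ d)
    (b * L) hV3 k hkm hwin
  rw [klTowerTransfer_succ]
  exact transferWtData_klSrcTransfer_of_frame_telescope_tn hβ0 μ (fun i => klFlowFrameU L M β U μ i) k m₀ d hCr.le hΛT0 hΛTle hbrow hbcol χ χ'
    hχ hχ' hrow hcol

end TransferBundle

end Summit.HubbardSuperconductivity.HubbardSuperconductivity.Theorems.TorusFourierL2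

end
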